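import Summits.QuantumFields.YangMills.Theorems.BalabanUVNodesN09RTGaugeInvarianceOn
import Summits.QuantumFields.YangMills.Theorems.BalabanUVNodesN09LiftInvariance29AtRecord
import Literature.MathematicalPhysics.QuantumFieldTheory.Balaban1983to89.B12NodeKnitRecord13SepCoPH

/-!
# NODE N09 AT THE STAGE-13 v1.7 `SepCoPH` RECORD WITHOUT (M1): the Theorem-3 member `smallCouplings → smallFieldInductive` from [B11] (181)-COVARIANCE OF THE
# CRITICAL CONFIGURATION ON THE SOLVABLE SET, bookkeeping sets INSIDE the solvable set, the localised support clause, (I19), [B11] Thm 1 ×3 and the nesting —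
# dag-n24-c's junction `B12NodeKnitRecord13SepCoPH` §2 RE-KEYED on this seat's localised engine (FILE 3)

TRACK A (YM-PLAN §2d, node N09 of 28), seat `pub-ymgap-dag-n09-w2` (D-0149 width seat 2∕4), FILE 4.  Key of record: K1⁷ `StabilityBAtRecordR13SepCoPH` = stmt-QuantumFields-20542;
`--supports` it as a helper (Summits lane).  [I] = [Balaban1987RG1] (CMP 109), [B11] = [Balaban1985Variational] (CMP 102), [B7] = [Balaban1985Averaging] (CMP 98).

WHY.  The junction's located form (p572963 §2 `thm3Member_stage13SepCoPH_of_stepsOn`) displays (M1) `hχinv : ∀ j < P.K, LiftInvariant (chiβOfRecord₁₃ θ P.K g j)`, which is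
FALSE in print's regime at the bare-choice record (this seat's FILE 2b `not_hχinv_stage13_SU2`).  The junk corner never meets a fibre over a SOLVABLE coarse field, and the
push-forward argument only integrates over fibres (FILE 3): so the member needs lift-invariance of `χ^{(2.9)}_j` only ON `Ū⁻¹(D (j+1))` for bookkeeping sets `D (j+1)` inside
the level-`(j+1)` SOLVABLE set at the cut-off's radius `θ.ν.εreg` — and THAT is [B11] (181)-covariance of the critical configuration (2.3) on the solvable set (FILE 1 §1).
* §1 **`TcanOfRecord_gaugeAct_of_liftInvariantOn`** — node00-def-K0e's `TcanOfRecord_gaugeAct_of_mem_regSet` LOCALISED: for `j < K`, an integrable `ρ` lift-invariant on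
  `Ū⁻¹(S)`, and `S` open, measurable, gauge-stable, inside the maximal regular set `regSetOfRecord K j ρ`, the canonical-version transform of record is invariant AT EVERY
  POINT of `S` (FILE 3 `invOn_of_isRT_of_liftInvariantOn` at K0e's `isRT_TcanOfRecord` ∕ `integrable_TcanOfRecord` ∕ `continuousOn_TcanOfRecord`); in the engine's shape
  **`stepOnLoc_TβOfRecord₁₃`**.
* §2 **`chiβ_liftInvariantOn_of_covariantOn`** — at any `θ₀ : Stage13Params`, (181)-covariance of `critCfgOfRecord θ₀.ν` on the level-`(j+1)` solvable set (radius
  `θ₀.ν.εreg`) gives lift-invariance of `chiβOfRecord₁₃ θ₀ K g j` on `Ū⁻¹(S)` for every `S` inside that solvable set (FILE 1 `chiFix29OfRecord_gaugeAct_liftTransf_of_covariantOn`).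
* §3 ★ **`thm3Member_stage13SepCoPH_of_stepsOnLoc`** ∕ **`b12_main_stage13SepCoPH_of_leaf_of_stepsOnLoc`** — the junction's §2 with (M1) REPLACED by: (181)ˢᵒˡ `hcov`
  (covariance of (2.3) on the solvable set, every step `j < K`), `hDsol` (`D (j+1) ⊆` solvable set at radius `θ.ν.εreg`), `hDo ∕ hDm ∕ hDst` (`D (j+1)` open, measurable,
  gauge-stable), the support clause LOCALISED to `Ū⁻¹(D (j+1))`; every other binder — (I19) `hint`, `hreg : D (j+1) ⊆ regSetOfRecord …`, [B11] ×3 at radius `θ.εbg` on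
  `domAltOfRecord θ.ν`, the nesting — VERBATIM.  Proof: FILE 3 `thm3Member_of_indATPlug_of_stepsOnLoc` at `T' := TβOfRecord₁₃`, `χ := chiβOfRecord₁₃ θ`, fed by the
  junction's §0 faces (`flow_stage13SepCoPH`, `indAss_stage13SepCoPH_iff`, by name), the cut-off's flow-blindness (`rfl`), §1 and §2.
LOCATED (not settled here): WHICH sets `D (j+1)` — they must be open, gauge-stable, inside `regSetOfRecord K j ρ_j` AND inside the solvable set at radius `θ.ν.εreg`, receive the
nested averaged minimisers, and carry the localised support clause (for `χ^{(2.9)}`: K0e's threshold hierarchy `mem_domAltOfRecord_of_chiFix29_eq_one` points at the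
small-field domains; [B11] Thm 1's existence clause is then wanted AT RADIUS `θ.ν.εreg` — at the V17 witness `εreg = a₀ ≠ εbg = 1`).

HONEST FRAMING: count-neutral composition BY NAME (this seat's FILES 1 ∕ 3, the junction's §0, K0e's canonical transport, dag-n09-a's plug); NOTHING of Bałaban's asserted —
(181), the set-theoretic side conditions, (I19), [B11] ×3 and the nesting are DISPLAYED hypotheses; N09 NOT discharged; K0⁷ ∕ K1⁷ OPEN; counts unmoved (typed 28∕28 ·
discharged 5∕27); R4 is the conditional finite-𝕋⁴ rung `BalabanLadder.UV` only — NOT continuum ∕ ℝ⁴ ∕ OS ∕ mass gap ∕ Clay.  THEOREMS ONLY (0 `def`, 0 `sorry`), standard axioms.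
-/

noncomputable section

namespace Summit.QuantumFields.YangMills.BalabanUVNodes.N09AtRecord13SepCoPHLoc

open MeasureTheory
open Literature.MathematicalPhysics.QuantumFieldTheory.Balaban1983to89
open Literature.MathematicalPhysics.QuantumFieldTheory.Balaban1983to89.Node00
open Literature.MathematicalPhysics.QuantumFieldTheory.Balaban1983to89.B12NodeKnitRecord13SepCoPH (flow_stage13SepCoPH indAss_stage13SepCoPH_iff)
open B12RTGaugeInvariance254 (LiftInvariant liftTransf)
open B12Eq019ActionBody (integrand)
open B12ContinuousTransportInvariance (isOpenPosMeasure_fieldMeasure_SU continuous_gaugeAct_SU)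
open B12NodeKnitRecord8 (b12_main_of_leaf_of_thm3Member)
open DagBinding
open GaugeField (gaugeAct)
open Summit.QuantumFields.YangMills.BalabanUVNodes.N09RTGaugeInvarianceOn (invOn_of_isRT_of_liftInvariantOn thm3Member_of_indATPlug_of_stepsOnLoc)
open Summit.QuantumFields.YangMills.BalabanUVNodes.N09LiftInvariance29AtRecord (chiFix29OfRecord_gaugeAct_liftTransf_of_covariantOn succ_le_range_of_lt)

variable {F : T4Continuum.T4Family} {N : ℕ} [NeZero N]

/-! ## §1. node00-def-K0e's on-set invariance of the canonical-version transport, LOCALISED -/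

/-- **THE CANONICAL-VERSION TRANSPORT OF RECORD IS GAUGE INVARIANT ON `S` FROM LIFT-INVARIANCE ON `Ū⁻¹(S)`** (`j < K`; `S` open, measurable, gauge-stable, inside the
maximal regular set of the transform of `ρ`; `ρ` integrable): `TcanOfRecord K j ρ (V^v) = TcanOfRecord K j ρ V` for every `V ∈ S` — K0e's `TcanOfRecord_gaugeAct_of_mem_regSet`
with its global `LiftInvariant ρ` replaced by the local hypothesis (FILE 3's push-forward argument + K0e's `isRT_TcanOfRecord`, `integrable_TcanOfRecord`, `continuousOn_TcanOfRecord`).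
[cite: Balaban1987RG1, (0.13) p.254, (2.1) p.265 and p.263; Balaban1988Convergent, (3.1) p.264] -/
theorem TcanOfRecord_gaugeAct_of_liftInvariantOn {K j : ℕ} (hj : j < K) {ρ : Density (F.P K) j (SU N)} (hρi : Integrable ρ (fieldMeasure (F.P K) j (SU N)))
    {S : Set (GaugeField (F.P K) (j + 1) (SU N))} (hSo : IsOpen S) (hS : MeasurableSet S)
    (hSst : ∀ (v : GaugeTransf (F.P K) (j + 1) (SU N)) (V : GaugeField (F.P K) (j + 1) (SU N)), V ∈ S → gaugeAct v V ∈ S)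
    (hSreg : S ⊆ regSetOfRecord F N K j ρ)
    (hρ : ∀ (v : GaugeTransf (F.P K) (j + 1) (SU N)) (U : GaugeField (F.P K) j (SU N)), (avOfRecord F N K j).avg U ∈ S → ρ (gaugeAct (liftTransf v) U) = ρ U) :
    ∀ (v : GaugeTransf (F.P K) (j + 1) (SU N)) (V : GaugeField (F.P K) (j + 1) (SU N)), V ∈ S → TcanOfRecord F N K j ρ (gaugeAct v V) = TcanOfRecord F N K j ρ V :=
  haveI := isOpenPosMeasure_fieldMeasure_SU N (F.P K) (j + 1)
  invOn_of_isRT_of_liftInvariantOn (continuous_gaugeAct_SU N (F.P K) (j + 1)) (succ_le_range_of_lt hj) (avOfRecord F N K j) (isRT_TcanOfRecord hj hρi)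
    (integrable_TcanOfRecord hj hρi) hSo hS hSst ((continuousOn_TcanOfRecord K j ρ).mono hSreg) hρ

/-- **THE LOCALISED PER-STEP PROPERTY OF `TβOfRecord₁₃ = TcanOfRecord`** in the shape FILE 3's engine reads (the `_on` twin of the junction's `stepOn_TβOfRecord₁₃_of_subset_regSet`).
[cite: Balaban1987RG1, (0.13) p.254 and p.263] -/
theorem stepOnLoc_TβOfRecord₁₃ {K j : ℕ} (hj : j < K) (ρ : Density (F.P K) j (SU N)) (hint : Integrable ρ (fieldMeasure (F.P K) j (SU N)))
    {D : Set (GaugeField (F.P K) (j + 1) (SU N))} (hDo : IsOpen D) (hDm : MeasurableSet D)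
    (hDst : ∀ (v : GaugeTransf (F.P K) (j + 1) (SU N)) (V : GaugeField (F.P K) (j + 1) (SU N)), V ∈ D → gaugeAct v V ∈ D) (hD : D ⊆ regSetOfRecord F N K j ρ) :
    (∀ (v : GaugeTransf (F.P K) (j + 1) (SU N)) (U : GaugeField (F.P K) j (SU N)), (avOfRecord F N K j).avg U ∈ D → ρ (gaugeAct (liftTransf v) U) = ρ U) →
      ∀ (v : GaugeTransf (F.P K) (j + 1) (SU N)) (V : GaugeField (F.P K) (j + 1) (SU N)), V ∈ D →
        TβOfRecord₁₃ F N K j ρ (gaugeAct v V) = TβOfRecord₁₃ F N K j ρ V :=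
  fun hρ => TcanOfRecord_gaugeAct_of_liftInvariantOn hj hint hDo hDm hDst hD hρ

/-! ## §2. The (2.9) cut-off of record is lift-invariant on `Ū⁻¹(S)`, `S` inside the solvable set, from (181)-covariance there -/

/-- **LOCAL LIFT-INVARIANCE OF `χ^{(2.9)}_j` FROM (181)-COVARIANCE ON THE SOLVABLE SET**: for `θ₀ : Stage13Params`, `j < K`, and `S` inside the level-`(j+1)` solvable set at the
cut-off's radius `θ₀.ν.εreg`, block-lift covariance of the critical configuration (2.3) at every solvable coarse field gives
`χ^{(2.9)}_j(U^{v∘B}) = χ^{(2.9)}_j(U)` whenever `ŪU ∈ S` (FILE 1 `chiFix29OfRecord_gaugeAct_liftTransf_of_covariantOn`; any coupling sequence — the cut-off is coupling-blind).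
[cite: Balaban1987RG1, (2.9) p.266 and (2.3) p.265; Balaban1985Variational, (181) p.307] -/
theorem chiβ_liftInvariantOn_of_covariantOn (θ₀ : Stage13Params F N) (K : ℕ) (g : ℕ → ℝ) {j : ℕ} (hj : j < K)
    {S : Set (GaugeField (F.P K) (j + 1) (SU N))} (hSsol : ∀ W ∈ S, UkExists F N K (j + 1) θ₀.ν.εreg W)
    (hcov : ∀ (v : GaugeTransf (F.P K) (j + 1) (SU N)) (W : GaugeField (F.P K) (j + 1) (SU N)), UkExists F N K (j + 1) θ₀.ν.εreg W →
      critCfgOfRecord F N θ₀.ν K j (gaugeAct v W) = gaugeAct (liftTransf v) (critCfgOfRecord F N θ₀.ν K j W)) :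
    ∀ (v : GaugeTransf (F.P K) (j + 1) (SU N)) (U : GaugeField (F.P K) j (SU N)), (avOfRecord F N K j).avg U ∈ S →
      chiβOfRecord₁₃ F N θ₀ K g j (gaugeAct (liftTransf v) U) = chiβOfRecord₁₃ F N θ₀ K g j U :=
  fun v U hU => chiFix29OfRecord_gaugeAct_liftTransf_of_covariantOn θ₀.ε₂₉ (succ_le_range_of_lt hj) hcov v U (hSsol _ hU)

/-! ## §3. The Theorem-3 member ∕ N09 at `(w, P)` for a world bound to the Stage-13 construction — (M1) replaced by (181) on the solvable set -/

/-- **★ THE THEOREM-3 MEMBER OF N09 AT `(w, P)`, STAGE-13 v1.7 CONSTRUCTION, WITHOUT (M1)**: for `w.C = (datumOfRecord₁₃SepCoPH θ h).C`, a run `P` and bookkeeping sets `D j`,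
`smallCouplings → smallFieldInductive` follows from — (181)ˢᵒˡ block-lift covariance of the critical configuration `critCfgOfRecord θ.ν P.K j` at every SOLVABLE coarse field
(radius `θ.ν.εreg`, `j < K`); `D (j+1)` OPEN, MEASURABLE, GAUGE-STABLE, inside that solvable set AND inside the maximal regular set `regSetOfRecord K j ρ_j`; the support clause
«`χ^{(2.9)}_j(U) = 0` for `ŪU ∈ D (j+1)`, `U ∉ D j`»; (I19) integrability of the (0.19) densities met; [B11] Thm 1's three binders on `domAltOfRecord θ.ν` at radius `θ.εbg`; the
nesting `Ū^j(U_k V) ∈ D j`.  (= the junction's `thm3Member_stage13SepCoPH_of_stepsOn` with `hχinv` ∕ the global support clause ∕ the global per-step property replaced by their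
localised forms; FILE 3 `thm3Member_of_indATPlug_of_stepsOnLoc` at `T' := TβOfRecord₁₃`, `χ := chiβOfRecord₁₃ θ`, fed by the junction's §0 faces, `rfl`, §1 and §2.)  CONDITIONAL on
every displayed hypothesis; nothing of Bałaban asserted; N09 NOT discharged.
[cite: Balaban1987RG1, Thm 3 p.264, (1.1)–(1.3) p.260, (0.13) p.254, p.263, (2.1)–(2.3) p.265, (2.9)–(2.10) pp.266–267, (2.16) p.269; Balaban1985Variational, Thm 1 (8)–(10) p.279 and (181) p.307] -/
theorem thm3Member_stage13SepCoPH_of_stepsOnLoc (θ : Stage13HParams F N) (h : θ.Provisos₁₃SepCoPH F N) {w : WorldP}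
    (hC : w.C = (datumOfRecord₁₃SepCoPH F N θ h).C) (P : B12.RunParams) (D : (j : ℕ) → Set (GaugeField (F.P P.K) j (SU N)))
    (hcov : ∀ j < P.K, ∀ (v : GaugeTransf (F.P P.K) (j + 1) (SU N)) (W : GaugeField (F.P P.K) (j + 1) (SU N)),
      UkExists F N P.K (j + 1) θ.toStage13Params.ν.εreg W →
        critCfgOfRecord F N θ.toStage13Params.ν P.K j (gaugeAct v W) = gaugeAct (liftTransf v) (critCfgOfRecord F N θ.toStage13Params.ν P.K j W))
    (hDsol : ∀ j < P.K, ∀ W ∈ D (j + 1), UkExists F N P.K (j + 1) θ.toStage13Params.ν.εreg W)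
    (hDo : ∀ j < P.K, IsOpen (D (j + 1))) (hDm : ∀ j < P.K, MeasurableSet (D (j + 1)))
    (hDst : ∀ j < P.K, ∀ (v : GaugeTransf (F.P P.K) (j + 1) (SU N)) (V : GaugeField (F.P P.K) (j + 1) (SU N)), V ∈ D (j + 1) → gaugeAct v V ∈ D (j + 1))
    (hχD : ∀ j < P.K, ∀ U : GaugeField (F.P P.K) j (SU N), (avOfRecord F N P.K j).avg U ∈ D (j + 1) → U ∉ D j →
      chiβOfRecord₁₃ F N θ.toStage13Params P.K (gOfRecord₁₃ F N θ.toStage13Params P) j U = 0)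
    (hint : ∀ j < P.K, Integrable (betaInputOfRecord F N (TβOfRecord₁₃ F N) (chiβOfRecord₁₃ F N θ.toStage13Params) P.K (gOfRecord₁₃ F N θ.toStage13Params P) j)
      (fieldMeasure (F.P P.K) j (SU N)))
    (hreg : ∀ j < P.K, D (j + 1) ⊆ regSetOfRecord F N P.K j
      (betaInputOfRecord F N (TβOfRecord₁₃ F N) (chiβOfRecord₁₃ F N θ.toStage13Params) P.K (gOfRecord₁₃ F N θ.toStage13Params P) j))
    (h11 : ∀ k, k ≤ P.K → ∀ V ∈ domAltOfRecord F N θ.ν P.K k, UkExists F N P.K k θ.εbg V ∧ UniqueUkOrbit F N P.K k θ.εbg V)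
    (hres : ∀ k, k ≤ P.K → HRestrict F N θ.εbg P.K k (domAltOfRecord F N θ.ν P.K k))
    (huniq : ∀ k, k ≤ P.K → ∀ V ∈ domAltOfRecord F N θ.ν P.K k, ∀ j < k,
      UniqueUkOrbit F N P.K (j + 1) θ.εbg (Averaging.iter (avOfRecord F N P.K) (j + 1) (Uk F N P.K k θ.εbg V)))
    (hnest : ∀ k, k ≤ P.K → ∀ V ∈ domAltOfRecord F N θ.ν P.K k, ∀ j < k, Averaging.iter (avOfRecord F N P.K) j (Uk F N P.K k θ.εbg V) ∈ D j) :
    (leavesP w P).smallCouplings → (leavesP w P).smallFieldInductive :=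
  thm3Member_of_indATPlug_of_stepsOnLoc (TβOfRecord₁₃ F N) (chiβOfRecord₁₃ F N θ.toStage13Params) θ.εbg (betaOfRecord₁₃ F N θ.toStage13Params)
    (fun k => domAltOfRecord F N θ.ν P.K k) D
    (by rw [hC]; exact flow_stage13SepCoPH F N θ h P) (fun k _ => by rw [hC]; exact indAss_stage13SepCoPH_iff F N θ h P k)
    (fun _ _ _ _ => rfl)
    (fun j hj => chiβ_liftInvariantOn_of_covariantOn θ.toStage13Params P.K (gOfRecord₁₃ F N θ.toStage13Params P) hj (hDsol j hj) (hcov j hj)) hχD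
    (fun j hj => stepOnLoc_TβOfRecord₁₃ hj _ (hint j hj) (hDo j hj) (hDm j hj) (hDst j hj) (hreg j hj)) h11 hres huniq hnest

/-- **N09 AT `(w, P)`, STAGE-13 v1.7 CONSTRUCTION, WITHOUT (M1)**: its own leaf `b12` ([I] Lemma 4) + the inputs of `thm3Member_stage13SepCoPH_of_stepsOnLoc` ⇒
`Dag.B12_main (leavesP w P)`.  CONDITIONAL; N09 NOT discharged. [cite: Balaban1987RG1, Lemma 4 (3.53) p.280, Thm 3 p.264 and (1.1)–(1.3) p.260; Balaban1985Variational, Thm 1 p.279 and (181) p.307] -/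
theorem b12_main_stage13SepCoPH_of_leaf_of_stepsOnLoc (θ : Stage13HParams F N) (h : θ.Provisos₁₃SepCoPH F N) {w : WorldP}
    (hC : w.C = (datumOfRecord₁₃SepCoPH F N θ h).C) (P : B12.RunParams) (h12 : (leavesP w P).b12) (D : (j : ℕ) → Set (GaugeField (F.P P.K) j (SU N)))
    (hcov : ∀ j < P.K, ∀ (v : GaugeTransf (F.P P.K) (j + 1) (SU N)) (W : GaugeField (F.P P.K) (j + 1) (SU N)),
      UkExists F N P.K (j + 1) θ.toStage13Params.ν.εreg W →
        critCfgOfRecord F N θ.toStage13Params.ν P.K j (gaugeAct v W) = gaugeAct (liftTransf v) (critCfgOfRecord F N θ.toStage13Params.ν P.K j W))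
    (hDsol : ∀ j < P.K, ∀ W ∈ D (j + 1), UkExists F N P.K (j + 1) θ.toStage13Params.ν.εreg W)
    (hDo : ∀ j < P.K, IsOpen (D (j + 1))) (hDm : ∀ j < P.K, MeasurableSet (D (j + 1)))
    (hDst : ∀ j < P.K, ∀ (v : GaugeTransf (F.P P.K) (j + 1) (SU N)) (V : GaugeField (F.P P.K) (j + 1) (SU N)), V ∈ D (j + 1) → gaugeAct v V ∈ D (j + 1))
    (hχD : ∀ j < P.K, ∀ U : GaugeField (F.P P.K) j (SU N), (avOfRecord F N P.K j).avg U ∈ D (j + 1) → U ∉ D j →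
      chiβOfRecord₁₃ F N θ.toStage13Params P.K (gOfRecord₁₃ F N θ.toStage13Params P) j U = 0)
    (hint : ∀ j < P.K, Integrable (betaInputOfRecord F N (TβOfRecord₁₃ F N) (chiβOfRecord₁₃ F N θ.toStage13Params) P.K (gOfRecord₁₃ F N θ.toStage13Params P) j)
      (fieldMeasure (F.P P.K) j (SU N)))
    (hreg : ∀ j < P.K, D (j + 1) ⊆ regSetOfRecord F N P.K j
      (betaInputOfRecord F N (TβOfRecord₁₃ F N) (chiβOfRecord₁₃ F N θ.toStage13Params) P.K (gOfRecord₁₃ F N θ.toStage13Params P) j))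
    (h11 : ∀ k, k ≤ P.K → ∀ V ∈ domAltOfRecord F N θ.ν P.K k, UkExists F N P.K k θ.εbg V ∧ UniqueUkOrbit F N P.K k θ.εbg V)
    (hres : ∀ k, k ≤ P.K → HRestrict F N θ.εbg P.K k (domAltOfRecord F N θ.ν P.K k))
    (huniq : ∀ k, k ≤ P.K → ∀ V ∈ domAltOfRecord F N θ.ν P.K k, ∀ j < k,
      UniqueUkOrbit F N P.K (j + 1) θ.εbg (Averaging.iter (avOfRecord F N P.K) (j + 1) (Uk F N P.K k θ.εbg V)))
    (hnest : ∀ k, k ≤ P.K → ∀ V ∈ domAltOfRecord F N θ.ν P.K k, ∀ j < k, Averaging.iter (avOfRecord F N P.K) j (Uk F N P.K k θ.εbg V) ∈ D j) :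
    Dag.B12_main (leavesP w P) :=
  b12_main_of_leaf_of_thm3Member h12
    (thm3Member_stage13SepCoPH_of_stepsOnLoc θ h hC P D hcov hDsol hDo hDm hDst hχD hint hreg h11 hres huniq hnest)

end Summit.QuantumFields.YangMills.BalabanUVNodes.N09AtRecord13SepCoPHLoc
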